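import Literature.NumberTheory.EllipticCurves.Kramer1981.ArchimedeanNormIndexProofs
import Literature.NumberTheory.EllipticCurves.ArchimedeanKummerImageMaximal
import Literature.NumberTheory.EllipticCurves.LocalKummerMap
import HarnessLib

/-!
# Route `GenusKolyvaginAtTwo`, crux #2 `GenusPrimitiveSupplyAtTwo` (stmt-BirchSwinnertonDyer-22136):
# the ORDER of the archimedean Kummer condition — `#𝓛_w = [E(K_w) : 2E(K_w)] = 2` at a real place `w`
# with `Δ_E >_w 0`, `= 1` with `Δ_E <_w 0` (Kramer 1981, §2 Prop. 6, transported to `K_w`)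

Width seat `bsd-line-gk2-p5` g9 (cell `bsd-f1-sign2`, SUPPLY lineage, «UP general-K lane»), file 20 of the series (sequel of
`…ArchimedeanKummerCount.lean` / `…ArchimedeanTransfer.lean`). THEOREMS ONLY (no definition, no named fact, no `sorry`, no local
instance); helper `--supports stmt-BirchSwinnertonDyer-22136`; no item is closed; BSD is not proved by any of this.

WHAT. Parts 1–3 of the archimedean series reduce Mazur–Rubin's Cor. 3.4 (i) with an ARCHIMEDEAN `T`-place (the cell's T-A / T-V /
T-C supply rows for `Δ_E > 0`) to two local facts at the real place `w`; this file proves the first one, input (α) of the crux memo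
`Lines/genus-supply-mr-instantiation.md` §6: the local Kummer condition `𝓛_w = 𝓚_{E,w} ⊂ H¹(K_w, E[2])` has

* §48 `index_range_zsmulAddGroupHom_eq_of_ringEquiv` — `[E(F) : nE(F)] = [E(L) : nE(L)]` along a ring isomorphism `F ≃+* L`
  (transport of Mathlib's rational points, `nonempty_addEquiv_point_of_ringEquiv`);
* §49 `index_range_zsmulAddGroupHom_two_completion_eq_two_of_isReal` / `range_zsmulAddGroupHom_two_completion_eq_top_of_isReal` —
  `[E(K_w) : 2E(K_w)] = 2` if `0 < w(Δ_E)`, `2E(K_w) = E(K_w)` if `w(Δ_E) < 0` (`K_w ≃+* ℝ`, Mathlib `ringEquivRealOfIsReal`, and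
  Kramer's `index_range_two_eq_two_of_Δ_pos` / `range_two_eq_top_of_Δ_neg` over `ℝ`);
* §50 `natCard_kummerSelmerStructure_inl_eq_two_of_isReal` / `…_eq_one_of_isReal` — `#𝓛_w = 2` resp. `1` (local Kummer
  sequence `natCard_kummerLocalConditionAt_eq_index`), and the `ℚ`-forms `natCard_kummerSelmerStructure_inl_rat_eq_two_of_Δ_pos` /
  `…_eq_one_of_Δ_neg` (`0 < W.Δ` resp. `W.Δ < 0`), which feed `ht : Nat.card (𝓚 (Sum.inl w)) = 2` of part 3's
  `natCard_selmerGroup_mul_eq_of_transverse_inl_of_localization_ne_zero` /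
  `natCard_selmerGroup_eq_mul_of_transverse_inl_of_forall_localization_eq_zero` at `p = 2`.

References: [Kramer1981] §2 Prop. 6 (p. 127); [MilneADT2006] I Rem. 3.7, I §6 (proof of Lemma 6.15); [SilvermanAEC2009] X.§4.
-/

set_option linter.dupNamespace false -- tree convention: `Summit.BirchSwinnertonDyer.BirchSwinnertonDyer.Theorems` (summit = sub-problem)
set_option autoImplicit false

noncomputable section

open scoped Classical
open NumberField WeierstrassCurve

namespace Summit.BirchSwinnertonDyer.BirchSwinnertonDyer.Theorems.GenusKolyArch

universe u

/-! ## §48 Transport of `[E(F) : nE(F)]` along a ring isomorphism of the base field -/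

section Transport

variable {K : Type u} [Field K] (W : WeierstrassCurve K)
variable {F : Type*} [Field F] [Algebra K F] {L : Type*} [Field L]

/-- **`[E(F) : nE(F)] = [E(L) : nE(L)]` along `f : F ≃+* L`** (`L` given the `K`-algebra structure through `f`): the additive
isomorphism `E(F) ≃+ E(L)` of `nonempty_addEquiv_point_of_ringEquiv` maps `nE(F)` onto `nE(L)`, and the index is invariant under
a bijective homomorphism. [folklore] -/
theorem index_range_zsmulAddGroupHom_eq_of_ringEquiv (f : F ≃+* L) (n : ℤ) :
    letI : Algebra K L := (f.toRingHom.comp (algebraMap K F)).toAlgebra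
    (zsmulAddGroupHom n : (W.baseChange F).toAffine.Point →+ _).range.index =
      (zsmulAddGroupHom n : (W.baseChange L).toAffine.Point →+ _).range.index := by
  letI : Algebra K L := (f.toRingHom.comp (algebraMap K F)).toAlgebra
  obtain ⟨φ⟩ := W.nonempty_addEquiv_point_of_ringEquiv f
  have hmap : ((zsmulAddGroupHom n : (W.baseChange F).toAffine.Point →+ _).range).map
      (φ : (W.baseChange F).toAffine.Point →+ (W.baseChange L).toAffine.Point) =
      (zsmulAddGroupHom n : (W.baseChange L).toAffine.Point →+ _).range := by
    ext Q
    simp only [AddSubgroup.mem_map, AddMonoidHom.mem_range, AddMonoidHom.coe_coe, zsmulAddGroupHom_apply]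
    constructor
    · rintro ⟨P, ⟨R, rfl⟩, rfl⟩
      exact ⟨φ R, (map_zsmul φ n R).symm⟩
    · rintro ⟨R, rfl⟩
      exact ⟨n • φ.symm R, ⟨φ.symm R, rfl⟩, by rw [map_zsmul, AddEquiv.apply_symm_apply]⟩
  rw [← hmap, AddSubgroup.index_map_equiv]

end Transport

/-! ## §49 `[E(K_w) : 2E(K_w)]` at a real place, by the sign of `w(Δ)` -/

section RealPlace

variable {K : Type u} [Field K] (W : WeierstrassCurve K) [W.IsElliptic]

/-- The real number `w(x)` attached to `x ∈ K` at a real place `w` is the image of `x` under `K → K_w ≃+* ℝ`. [folklore] -/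
theorem ringEquivRealOfIsReal_algebraMap {w : InfinitePlace K} (hw : w.IsReal) (x : K) :
    InfinitePlace.Completion.ringEquivRealOfIsReal hw (algebraMap K w.Completion x) =
      InfinitePlace.embedding_of_isReal hw x := by
  simp

omit [W.IsElliptic] in
/-- The discriminant of `E ⊗ ℝ` (through `K → K_w ≃+* ℝ` at a real place `w`) is `w(Δ_E)`. [folklore] -/
theorem Δ_baseChange_real_eq {w : InfinitePlace K} (hw : w.IsReal) :
    letI : Algebra K ℝ :=
      ((InfinitePlace.Completion.ringEquivRealOfIsReal hw).toRingHom.comp (algebraMap K w.Completion)).toAlgebra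
    (W.baseChange ℝ).Δ = InfinitePlace.embedding_of_isReal hw W.Δ := by
  letI : Algebra K ℝ :=
    ((InfinitePlace.Completion.ringEquivRealOfIsReal hw).toRingHom.comp (algebraMap K w.Completion)).toAlgebra
  rw [WeierstrassCurve.baseChange, WeierstrassCurve.map_Δ, ← ringEquivRealOfIsReal_algebraMap hw]
  rfl

/-- **`Δ_E >_w 0` ⇒ `[E(K_w) : 2E(K_w)] = 2`** at a real place `w` of `K`: transport along `K_w ≃+* ℝ` (§48) of Kramer's
`[E(ℝ) : 2E(ℝ)] = 2` for `Δ > 0` (`Kramer1981.index_range_two_eq_two_of_Δ_pos`). [cite: Kramer1981, §2 Prop. 6 (p. 127)] -/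
theorem index_range_zsmulAddGroupHom_two_completion_eq_two_of_isReal {w : InfinitePlace K} (hw : w.IsReal)
    (hΔ : 0 < InfinitePlace.embedding_of_isReal hw W.Δ) :
    (zsmulAddGroupHom 2 : (W.baseChange w.Completion).toAffine.Point →+ _).range.index = 2 := by
  letI : Algebra K ℝ :=
    ((InfinitePlace.Completion.ringEquivRealOfIsReal hw).toRingHom.comp (algebraMap K w.Completion)).toAlgebra
  rw [index_range_zsmulAddGroupHom_eq_of_ringEquiv W (InfinitePlace.Completion.ringEquivRealOfIsReal hw) 2]
  have hΔ' : 0 < (W.baseChange ℝ).Δ := by rwa [Δ_baseChange_real_eq W hw]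
  have hK := Literature.NumberTheory.EllipticCurves.Kramer1981.index_range_two_eq_two_of_Δ_pos (W.baseChange ℝ) hΔ'
  rw [show (2 : ℤ) = ((2 : ℕ) : ℤ) from rfl, zsmulAddGroupHom_natCast]
  exact hK

/-- **`Δ_E <_w 0` ⇒ `2E(K_w) = E(K_w)`** at a real place `w` of `K`: transport along `K_w ≃+* ℝ` of Kramer's `E(ℝ) = 2E(ℝ)` for
`Δ < 0` (`Kramer1981.range_two_eq_top_of_Δ_neg`). [cite: Kramer1981, §2 Prop. 6 (p. 127)] -/
theorem index_range_zsmulAddGroupHom_two_completion_eq_one_of_isReal {w : InfinitePlace K} (hw : w.IsReal)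
    (hΔ : InfinitePlace.embedding_of_isReal hw W.Δ < 0) :
    (zsmulAddGroupHom 2 : (W.baseChange w.Completion).toAffine.Point →+ _).range.index = 1 := by
  letI : Algebra K ℝ :=
    ((InfinitePlace.Completion.ringEquivRealOfIsReal hw).toRingHom.comp (algebraMap K w.Completion)).toAlgebra
  rw [index_range_zsmulAddGroupHom_eq_of_ringEquiv W (InfinitePlace.Completion.ringEquivRealOfIsReal hw) 2]
  have hΔ' : (W.baseChange ℝ).Δ < 0 := by rwa [Δ_baseChange_real_eq W hw]
  have hK := Literature.NumberTheory.EllipticCurves.Kramer1981.range_two_eq_top_of_Δ_neg (W.baseChange ℝ) hΔ'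
  rw [show (2 : ℤ) = ((2 : ℕ) : ℤ) from rfl, zsmulAddGroupHom_natCast, AddSubgroup.index_eq_one]
  exact hK

/-! ## §50 The order of the archimedean Kummer condition -/

/-- **`#𝓛_w = 2` at a real place `w` with `Δ_E >_w 0`**: the local Kummer condition `𝓛_w ⊂ H¹(K_w, E[2])` (local condition of
the Kummer Selmer structure at `Sum.inl w`) has order `[E(K_w) : 2E(K_w)]` (`natCard_kummerLocalConditionAt_eq_index`), `= 2` by
§49. Milne, *ADT*, I Rem. 3.7 / §6; Kramer 1981 §2 Prop. 6. [cite: Kramer1981, §2 Prop. 6 (p. 127)] -/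
theorem natCard_kummerSelmerStructure_inl_eq_two_of_isReal [NumberField K] {w : InfinitePlace K} (hw : w.IsReal)
    (hΔ : 0 < InfinitePlace.embedding_of_isReal hw W.Δ) :
    Nat.card (W.kummerSelmerStructure (2 : ℤ) (Sum.inl w)) = 2 := by
  haveI : CharZero w.Completion := charZero_of_injective_algebraMap (algebraMap K w.Completion).injective
  rw [kummerSelmerStructure_apply]
  change Nat.card (W.kummerLocalConditionAt 2 w.Completion) = 2
  rw [W.natCard_kummerLocalConditionAt_eq_index w.Completion two_ne_zero]
  exact index_range_zsmulAddGroupHom_two_completion_eq_two_of_isReal W hw hΔ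

/-- **`#𝓛_w = 1` at a real place `w` with `Δ_E <_w 0`** (`E(K_w)` is `2`-divisible). Milne, *ADT*, I Rem. 3.7; Kramer 1981 §2
Prop. 6. [cite: Kramer1981, §2 Prop. 6 (p. 127)] -/
theorem natCard_kummerSelmerStructure_inl_eq_one_of_isReal [NumberField K] {w : InfinitePlace K} (hw : w.IsReal)
    (hΔ : InfinitePlace.embedding_of_isReal hw W.Δ < 0) :
    Nat.card (W.kummerSelmerStructure (2 : ℤ) (Sum.inl w)) = 1 := by
  haveI : CharZero w.Completion := charZero_of_injective_algebraMap (algebraMap K w.Completion).injective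
  rw [kummerSelmerStructure_apply]
  change Nat.card (W.kummerLocalConditionAt 2 w.Completion) = 1
  rw [W.natCard_kummerLocalConditionAt_eq_index w.Completion two_ne_zero]
  exact index_range_zsmulAddGroupHom_two_completion_eq_one_of_isReal W hw hΔ

end RealPlace

/-! ## §50 (bis) Over `ℚ`: by the sign of `W.Δ` -/

section Rat

variable (W : WeierstrassCurve ℚ) [W.IsElliptic]

/-- Over `ℚ` the real number attached to `x` at the (real) infinite place is `x` itself. [folklore] -/
theorem embedding_of_isReal_rat_apply {w : InfinitePlace ℚ} (hw : w.IsReal) (x : ℚ) :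
    InfinitePlace.embedding_of_isReal hw x = x :=
  eq_ratCast _ x

/-- **`#𝓛_∞ = 2` for `E/ℚ` with `Δ_E > 0`** (`E(ℝ) ≅ S¹ × ℤ/2`, `[E(ℝ) : 2E(ℝ)] = 2`): the value of `ht : Nat.card (𝓚 (Sum.inl w)) = 2`
in part 3's archimedean Cor. 3.4 (i). [cite: Kramer1981, §2 Prop. 6 (p. 127)] -/
theorem natCard_kummerSelmerStructure_inl_rat_eq_two_of_Δ_pos (hΔ : 0 < W.Δ) (w : InfinitePlace ℚ) :
    Nat.card (W.kummerSelmerStructure (2 : ℤ) (Sum.inl w)) = 2 := by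
  have hw : w.IsReal := by rw [Subsingleton.elim w Rat.infinitePlace]; exact Rat.isReal_infinitePlace
  exact natCard_kummerSelmerStructure_inl_eq_two_of_isReal W hw
    (by rwa [embedding_of_isReal_rat_apply, Rat.cast_pos])

/-- **`#𝓛_∞ = 1` for `E/ℚ` with `Δ_E < 0`** (`E(ℝ) ≅ S¹` is `2`-divisible). [cite: Kramer1981, §2 Prop. 6 (p. 127)] -/
theorem natCard_kummerSelmerStructure_inl_rat_eq_one_of_Δ_neg (hΔ : W.Δ < 0) (w : InfinitePlace ℚ) :
    Nat.card (W.kummerSelmerStructure (2 : ℤ) (Sum.inl w)) = 1 := by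
  have hw : w.IsReal := by rw [Subsingleton.elim w Rat.infinitePlace]; exact Rat.isReal_infinitePlace
  exact natCard_kummerSelmerStructure_inl_eq_one_of_isReal W hw
    (by rwa [embedding_of_isReal_rat_apply, Rat.cast_lt_zero])

end Rat

end Summit.BirchSwinnertonDyer.BirchSwinnertonDyer.Theorems.GenusKolyArch

end
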